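import Mathlib.Analysis.Calculus.Gradient.Basic
import Mathlib.Analysis.Calculus.LocalExtr.Basic
import Mathlib.Analysis.Calculus.Deriv.MeanValue
import Mathlib.Analysis.InnerProductSpace.Adjoint
import Summits.QuantumFields.YangMills.Theorems.UnitScaleTiltFluctuationComparisonRegPrGlobalSlackKernelLegCfgVariational
import HarnessLib

/-!
# `UnitScaleTiltFluctuationComparisonRegPrGlobalSlackKernelLegCfgVariationalEnvelope` — THE TWO CALCULUS BRIDGES BEHIND THE VARIATIONAL DISPLAYS OF
# `…KernelLegCfgVariational`: (Grad) WITHOUT DIFFERENTIATING THE ONE-STEP MINIMISER (envelope formula) and (Mono) FROM A SECOND-VARIATION LOWER BOUND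
# (crux `FluctuationComparisonRegPrIntL`, stmt-QuantumFields-20520, skeletons v5kC / v5kD, STUB 3⁗χ `stub_globalTwoRunSlackFamChi`; cell `pub/ym-inputs`, seat ym-inputs-p12 =
# INPUT-LIST I-11 row `CfgDistCauchyΦ`; count-neutral helper, def-free, registry untouched)

WHERE THIS SITS.  `cfgDistCauchyΦ_of_variational` (`…KernelLegCfgVariational` §3) reads the I-11 row `CfgDistCauchyΦ` from four displays at a chart of run `K`'s constraint /
gauge slice: (Crit) the averaged run-`(K+1)` minimiser `w` is critical for the one-step classical effective action `f̃ = A¹_{K+1} ∘ chart`, (Mono) `∇f̃` is `m`-strongly monotone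
between `u = coord(U_K)` and `w`, (Grad) run `K`'s minimiser `u` is a `Λ`-approximate critical point of `f̃`, (Rate) `Λ ≤ m`·budget.  Two of these ask the supplier to handle
`f̃(x) = A_{K+1}(σ(x))`, where `σ(x)` is THE ONE-STEP CONSTRAINED MINIMISER of run `(K+1)`'s action over the fibre of `chart(x)` ([Balaban1985Variational] Thm 1 at `k = 1`).
This file supplies the two generic calculus bridges that make them statements about the ACTION, not about derivatives of `σ`:

* §1 **THE ENVELOPE FORMULA** (real normed spaces, Fréchet level).  `π : 𝔸 → ℬ` (one-step averaging, fine → coarse), `σ : ℬ → 𝔸` a selection (`π ∘ σ = id`) differentiable at `W`,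
  `A : 𝔸 → ℝ` differentiable at `σ W` with derivative `A′` VANISHING ON `ker π′` (the Euler–Lagrange equation of the one-step minimiser along its fibre, [Balaban1985Variational]
  (141) p.299 / (170)–(171) p.305: «⟨δA′, J⟩ = 0 for all δA′ : QδA′ = 0, RD*δA′ = 0», `Φ*(U_k)J = 0`).  Then for ANY continuous linear lift `ℓ` of `π′` (`π′ ∘ ℓ = id`): ★`hasFDerivAt_comp_of_envelope` — `D(A ∘ σ)(W) = A′ ∘ ℓ`; the derivative of the one-step minimiser
  drops out (`comp_fderiv_eq_comp_lift`: `A′ ∘ σ′ = A′ ∘ ℓ` because `σ′ v − ℓ v ∈ ker π′`, `π′ ∘ σ′ = id` by `fderiv_comp_selection_eq_id`).  Hilbert-space reading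
  ★`hasGradientAt_comp_of_envelope`: `∇(A ∘ σ)(W) = ℓ† ∇A(σ W)`.  For an AFFINE constraint (`π` continuous linear: lines `t ↦ σW + t•v`, `v ∈ ker π`, stay in the fibre) the
  Euler–Lagrange input follows from minimality on a fibre-neighbourhood (`fderiv_apply_eq_zero_of_isMinOn_fibre`, Fermat along lines).
* §2 **(Mono) FROM A SECOND-VARIATION LOWER BOUND ALONG THE SEGMENT**: ★`strongMono_of_deriv_ge` — if `φ(t) = ⟪g(u + t•(w−u)), w−u⟫` (`g` = the gradient field) has a derivative
  `ψ t ≥ m‖w−u‖²` on `[0,1]` (the second variation of `f̃` along the segment is `≥ m`: [Balaban1985Variational] (142) p.299 «a second order differential at A′ = 0 … is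
  positive definite», Prop. 7; the contraction (116)–(121), Prop. 6 p.295; [Balaban1985BackgroundPropagators] Thm 3.11, positivity of `G(U₀)`), then `m‖w−u‖² ≤ ⟪g w − g u, w−u⟫` (Mathlib's monotonicity-from-derivative `Convex.mul_sub_le_image_sub_of_le_deriv` on `[0,1]`).
* §3 **THE TWO-CUT-OFF COMPARISON FROM THE FINE CURRENT** ★`norm_sub_le_div_of_current`: `w` a local minimiser of `f̃` with a gradient there (so `∇f̃ w = 0`, Mathlib's Fermat),
  (Mono), and `∇f̃ u = ℓ† ∇A(σ u)` by the envelope with ★(Cur) `‖ℓ† ∇A(σ u)‖ ≤ Λ` ⟹ `‖w − u‖ ≤ Λ/m` — (Grad) of `…CfgVariational` now reads: «the first variation of run `(K+1)`'s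
  action AT THE ONE-STEP INTERPOLATION `σ(U_K)` of run `K`'s minimiser, tested on LIFTED slice directions, is `≤ Λ`» — for the abelian/linearised model exactly
  [King1986] Prop. 3.9's «difference of propagators on one line» (`ℓ† Δ_{K+1} σ − Δ_K` on smooth fields, with run `K`'s Euler–Lagrange equation `∇A_K(U_K) ⊥` slice).
* §4 **THE QUADRATIC MODEL** ★`quadratic_oneStep`: for `A(x) = ½⟪x,Sx⟫` (symmetric, nonnegative, inverse `G`), linear averaging `Q` and `E = (QGQ†)⁻¹` (as a right inverse), the
  one-step minimiser is Bałaban's `H b = GQ†Eb` (`B6SectA.hOp` shape; fibre, Euler–Lagrange, minimality PROVED) and `ℓ†∇A(Hb) = Eb` for EVERY lift — the envelope formula returns the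
  NEXT-SCALE INVERSE PROPAGATOR `(QGQ†)⁻¹` (composition law of propagators, [Balaban1984PropagatorsII] (2.17)–(2.23)); `grad_of_propagatorDifference`: with run `K`'s Euler–Lagrange
  equation on the slice, (Grad) is a bound on `((QG_{K+1}Q†)⁻¹ − c·S_K)u` tested on slice directions — [King1986] Prop. 3.9's difference of propagators, on ONE smooth field.
* §5 **THE JUNCTION WITH THE SUP-NORM ROUTE** (✓ `norm_sub_le_weighted_of_isFixedPt` of `…KernelLegCfgFixedPoint` §1 on the fine bond-indexed chart, then
  ✓ `cfgDistCauchyΦ_of_fineComparison`): for the Picard map `T x = x − G(J x)` of a current `J`, fixed points = zeros of `G ∘ J` (`isFixedPt_picard_iff`) and the defect at `u` is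
  `‖G(J u)‖ ≤ ‖G‖·Λ` (★`norm_picard_sub_self_le`) — so with `T` := the Picard map ([Balaban1985Variational] (116)) of `A¹_{K+1} ∘ chart` on run `K`'s slice, the contraction
  bound's defect at `U_K` is `G_K` applied to the SAME current (Cur) (envelope, §1); the
  Hilbert route (§3, strong monotonicity = an `L²` mechanism) and the sup-norm route (contraction in print's weighted norms (115), K-uniform) are two closures of ONE input;
  `norm_sub_le_div_of_pairing` = the core inequality in any normed space with the dual pairing, with the located caveat that sup-norm strong monotonicity fails for the Wilson
  action (`⟨h,Δ₁h⟩ ~ η^{d−2}‖h‖²_sup`), which is why print contracts instead.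
HONEST FRAMING.  Folklore calculus (chain rule, uniqueness of the Fréchet derivative, adjoint, mean-value monotonicity, Fermat) and Hilbert-space algebra; nothing of [Balaban1985Variational] /
[Balaban1985BackgroundPropagators] / [King1986] is asserted; (Cur) stays located-UNPRINTED for the non-abelian d = 3 model (E2 = NO); no configuration family is defined, no row
of 3⁗χ discharged; no summit / rung / gap claim (YM₃ on T³ is ladder rung R3, not the Clay problem).

References: T. Bałaban, CMP 96 (1984) 223–250 [Balaban1984PropagatorsII] (Sect. A (2.17)–(2.23) pp.225–226); CMP 102 (1985) 277–309 [Balaban1985Variational] (Thm 1 (8) p.279, (116)–(121) + Prop. 6 p.295, (141)–(142) + Prop. 7 p.299, (158) p.302,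
(170)–(171) + §G p.305); CMP 99 (1985) 389–434
[Balaban1985BackgroundPropagators] (Thm 3.11 p.416); C. King, CMP 102 (1986) 649–677 [King1986] (Prop. 3.9 (3.73)–(3.74) p.665).
-/

set_option autoImplicit false

noncomputable section

open scoped RealInnerProductSpace
open Set Filter Topology InnerProductSpace

namespace Summit.QuantumFields.YangMills.Theorems.GlobalSlackKernelLeg

/-! ## §1 The envelope formula: the first variation of the one-step effective action is the fine first variation composed with any lift -/

section Envelope

variable {𝔸 ℬ : Type*} [NormedAddCommGroup 𝔸] [NormedSpace ℝ 𝔸] [NormedAddCommGroup ℬ] [NormedSpace ℝ ℬ]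

/-- **A differentiable selection has a right-inverse derivative**: `π (σ W′) = W′` near `W`, `σ` differentiable at `W`, `π` differentiable at `σ W` ⟹ `π′ ∘ σ′ = id`
(chain rule + uniqueness of the Fréchet derivative). [folklore] -/
theorem fderiv_comp_selection_eq_id {π : 𝔸 → ℬ} {σ : ℬ → 𝔸} {W : ℬ} {π' : 𝔸 →L[ℝ] ℬ} {σ' : ℬ →L[ℝ] 𝔸}
    (hπσ : ∀ᶠ W' in 𝓝 W, π (σ W') = W') (hπ : HasFDerivAt π π' (σ W)) (hσ : HasFDerivAt σ σ' W) :
    π'.comp σ' = ContinuousLinearMap.id ℝ ℬ := by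
  have h1 : HasFDerivAt (π ∘ σ) (π'.comp σ') W := hπ.comp W hσ
  have h2 : HasFDerivAt (π ∘ σ) (ContinuousLinearMap.id ℝ ℬ) W :=
    (hasFDerivAt_id W).congr_of_eventuallyEq (hπσ.mono fun W' h => by simpa using h)
  exact h1.unique h2

/-- **THE DERIVATIVE OF THE MINIMISER DROPS OUT**: if `A′` vanishes on `ker π′` (Euler–Lagrange along the fibre) and `π′ ∘ σ′ = id`, then `A′ ∘ σ′ = A′ ∘ ℓ` for EVERY
continuous linear lift `ℓ` of `π′` (`σ′ v − ℓ v ∈ ker π′`). [cite: Balaban1985Variational, (141) p.299, (170)-(171) p.305] -/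
theorem comp_fderiv_eq_comp_lift {π' : 𝔸 →L[ℝ] ℬ} {σ' ℓ : ℬ →L[ℝ] 𝔸} {A' : 𝔸 →L[ℝ] ℝ}
    (hEL : ∀ v, π' v = 0 → A' v = 0) (hσ' : π'.comp σ' = ContinuousLinearMap.id ℝ ℬ) (hℓ : ∀ b, π' (ℓ b) = b) :
    A'.comp σ' = A'.comp ℓ := by
  ext b
  have hker : π' (σ' b - ℓ b) = 0 := by
    have := congrArg (fun T : ℬ →L[ℝ] ℬ => T b) hσ'
    simp only [ContinuousLinearMap.coe_comp, Function.comp_apply, ContinuousLinearMap.coe_id', id_eq] at this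
    rw [map_sub, this, hℓ, sub_self]
  have := hEL _ hker
  rw [map_sub, sub_eq_zero] at this
  simpa using this

/-- ★ **THE ENVELOPE FORMULA** (Fréchet level): `π ∘ σ = id` near `W`, `σ` differentiable at `W`, `π` differentiable at `σ W`, `A` differentiable at `σ W` with derivative vanishing
on `ker π′` (the one-step minimiser's Euler–Lagrange equation along its fibre) ⟹ for ANY continuous linear lift `ℓ` of `π′`, `D(A ∘ σ)(W) = A′ ∘ ℓ` — the first variation of the
one-step classical effective action is the fine first variation tested on lifted directions; no derivative of the minimiser appears. [cite: Balaban1985Variational, (141) p.299, (170)-(171) p.305, Thm 1 p.279] -/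
theorem hasFDerivAt_comp_of_envelope {π : 𝔸 → ℬ} {σ : ℬ → 𝔸} {A : 𝔸 → ℝ} {W : ℬ} {π' : 𝔸 →L[ℝ] ℬ} {σ' : ℬ →L[ℝ] 𝔸} {A' : 𝔸 →L[ℝ] ℝ}
    (hπσ : ∀ᶠ W' in 𝓝 W, π (σ W') = W') (hπ : HasFDerivAt π π' (σ W)) (hσ : HasFDerivAt σ σ' W) (hA : HasFDerivAt A A' (σ W))
    (hEL : ∀ v, π' v = 0 → A' v = 0) (ℓ : ℬ →L[ℝ] 𝔸) (hℓ : ∀ b, π' (ℓ b) = b) :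
    HasFDerivAt (A ∘ σ) (A'.comp ℓ) W := by
  rw [← comp_fderiv_eq_comp_lift hEL (fderiv_comp_selection_eq_id hπσ hπ hσ) hℓ]
  exact hA.comp W hσ

/-- **EULER–LAGRANGE ALONG AN AFFINE FIBRE FROM MINIMALITY**: for a continuous LINEAR constraint map `π`, if `x` minimises `A` over `S ∩ π⁻¹{π x}` with `S` a neighbourhood of
`x` (the one-step minimiser is interior to its regularity window) and `A` is differentiable at `x`, then `A′` vanishes on `ker π` (Fermat along the lines `t ↦ x + t•v`, which stay
in the fibre). [cite: Balaban1985Variational, (141) p.299, (158) p.302] -/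
theorem fderiv_apply_eq_zero_of_isMinOn_fibre (π : 𝔸 →L[ℝ] ℬ) {A : 𝔸 → ℝ} {S : Set 𝔸} {x : 𝔸} {A' : 𝔸 →L[ℝ] ℝ} (hS : S ∈ 𝓝 x)
    (hmin : IsMinOn A (S ∩ π ⁻¹' {π x}) x) (hA : HasFDerivAt A A' x) : ∀ v, π v = 0 → A' v = 0 := by
  intro v hv
  have hline : HasDerivAt (fun t : ℝ => x + t • v) v 0 := by
    simpa using ((hasDerivAt_id (0 : ℝ)).smul_const v).const_add x
  have hcomp : HasDerivAt (fun t : ℝ => A (x + t • v)) (A' v) 0 :=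
    HasFDerivAt.comp_hasDerivAt_of_eq (x := (0 : ℝ)) hA hline (by simp)
  have hcont : Tendsto (fun t : ℝ => x + t • v) (𝓝 0) (𝓝 x) := by
    simpa using hline.continuousAt.tendsto
  have hmem : ∀ᶠ t : ℝ in 𝓝 0, x + t • v ∈ S ∩ π ⁻¹' {π x} := by
    filter_upwards [hcont.eventually (eventually_mem_set.mpr hS)] with t ht
    exact ⟨ht, by simp [hv]⟩
  have hloc : IsLocalMin (fun t : ℝ => A (x + t • v)) 0 := by
    show ∀ᶠ t : ℝ in 𝓝 0, A (x + (0 : ℝ) • v) ≤ A (x + t • v)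
    simpa using hmem.mono fun t ht => hmin ht
  exact hloc.hasDerivAt_eq_zero hcomp

end Envelope

/-! ## §1′ Hilbert-space reading: `∇(A ∘ σ)(W) = ℓ† ∇A(σ W)` -/

section EnvelopeGradient

variable {𝔸 ℬ : Type*} [NormedAddCommGroup 𝔸] [InnerProductSpace ℝ 𝔸] [CompleteSpace 𝔸] [NormedAddCommGroup ℬ] [InnerProductSpace ℝ ℬ] [CompleteSpace ℬ]

/-- The dual of `ℓ† g` is the dual of `g` composed with `ℓ`: `⟪ℓ† g, b⟫ = ⟪g, ℓ b⟫`. [folklore] -/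
theorem toDual_adjoint_apply (ℓ : ℬ →L[ℝ] 𝔸) (g : 𝔸) :
    toDual ℝ ℬ ((ContinuousLinearMap.adjoint ℓ) g) = (toDual ℝ 𝔸 g).comp ℓ := by
  ext b
  simp only [toDual_apply_apply, ContinuousLinearMap.coe_comp, Function.comp_apply, ContinuousLinearMap.adjoint_inner_left]

/-- ★ **THE ENVELOPE FORMULA FOR GRADIENTS**: under the hypotheses of `hasFDerivAt_comp_of_envelope` with `A` having GRADIENT `g` at `σ W`, the one-step effective action
`A ∘ σ` has gradient `ℓ† g` at `W`, for any continuous linear lift `ℓ` of `π′` — «the first variation of `A¹` is the fine current pulled back by the adjoint lift».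
[cite: Balaban1985Variational, (170)-(171) p.305, Thm 1 p.279] -/
theorem hasGradientAt_comp_of_envelope {π : 𝔸 → ℬ} {σ : ℬ → 𝔸} {A : 𝔸 → ℝ} {W : ℬ} {π' : 𝔸 →L[ℝ] ℬ} {σ' : ℬ →L[ℝ] 𝔸} {g : 𝔸}
    (hπσ : ∀ᶠ W' in 𝓝 W, π (σ W') = W') (hπ : HasFDerivAt π π' (σ W)) (hσ : HasFDerivAt σ σ' W) (hA : HasGradientAt A g (σ W))
    (hEL : ∀ v, π' v = 0 → ⟪g, v⟫ = 0) (ℓ : ℬ →L[ℝ] 𝔸) (hℓ : ∀ b, π' (ℓ b) = b) :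
    HasGradientAt (A ∘ σ) ((ContinuousLinearMap.adjoint ℓ) g) W := by
  rw [hasGradientAt_iff_hasFDerivAt, toDual_adjoint_apply]
  refine hasFDerivAt_comp_of_envelope hπσ hπ hσ hA.hasFDerivAt (fun v hv => ?_) ℓ hℓ
  rw [toDual_apply_apply]; exact hEL v hv

/-- **THE SIZE OF THE PULLED-BACK CURRENT** is a supremum over lifted unit directions: `‖ℓ† g‖ ≤ Λ` as soon as `|⟪g, ℓ b⟫| ≤ Λ‖b‖` for all `b` (`Λ ≥ 0`). [folklore] -/
theorem norm_adjoint_apply_le (ℓ : ℬ →L[ℝ] 𝔸) (g : 𝔸) {Λ : ℝ} (hΛ : 0 ≤ Λ) (h : ∀ b, |⟪g, ℓ b⟫| ≤ Λ * ‖b‖) :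
    ‖(ContinuousLinearMap.adjoint ℓ) g‖ ≤ Λ := by
  set y := (ContinuousLinearMap.adjoint ℓ) g with hy
  have h1 : ‖y‖ ^ 2 ≤ Λ * ‖y‖ := by
    have := h y
    rw [← ContinuousLinearMap.adjoint_inner_left, ← hy, real_inner_self_eq_norm_sq, abs_of_nonneg (by positivity)] at this
    exact this
  rcases (norm_nonneg y).eq_or_lt with h0 | hpos
  · rw [← h0]; exact hΛ
  · nlinarith

end EnvelopeGradient

/-! ## §2 (Mono) from a second-variation lower bound along the segment -/

section Mono

variable {E : Type*} [NormedAddCommGroup E] [InnerProductSpace ℝ E]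

/-- ★ **STRONG MONOTONICITY BETWEEN A PAIR FROM A DERIVATIVE LOWER BOUND**: if `φ(t) := ⟪g(u + t•(w − u)), w − u⟫` has derivative `ψ t` at every `t ∈ [0,1]` with
`m‖w − u‖² ≤ ψ t` on `(0,1)` (the second variation of the functional along the segment is `≥ m`), then `m‖w − u‖² ≤ ⟪g w − g u, w − u⟫` — the input (Mono) of
`norm_sub_le_div_of_inner`. [cite: Balaban1985Variational, (142) p.299, (116)-(121) p.295] -/
theorem strongMono_of_deriv_ge (g : E → E) (u w : E) (ψ : ℝ → ℝ) {m : ℝ}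
    (hφ : ∀ t ∈ Icc (0 : ℝ) 1, HasDerivAt (fun s : ℝ => ⟪g (u + s • (w - u)), w - u⟫) (ψ t) t)
    (hψ : ∀ t ∈ Ioo (0 : ℝ) 1, m * ‖w - u‖ ^ 2 ≤ ψ t) :
    m * ‖w - u‖ ^ 2 ≤ ⟪g w - g u, w - u⟫ := by
  set φ : ℝ → ℝ := fun s => ⟪g (u + s • (w - u)), w - u⟫ with hφdef
  have hcont : ContinuousOn φ (Icc 0 1) := fun t ht => (hφ t ht).continuousAt.continuousWithinAt
  have hdiff : DifferentiableOn ℝ φ (interior (Icc 0 1)) := by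
    rw [interior_Icc]; exact fun t ht => (hφ t (Ioo_subset_Icc_self ht)).differentiableAt.differentiableWithinAt
  have hge : ∀ t ∈ interior (Icc (0 : ℝ) 1), m * ‖w - u‖ ^ 2 ≤ deriv φ t := by
    rw [interior_Icc]; intro t ht; rw [(hφ t (Ioo_subset_Icc_self ht)).deriv]; exact hψ t ht
  have h := (convex_Icc (0 : ℝ) 1).mul_sub_le_image_sub_of_le_deriv hcont hdiff hge 0 (left_mem_Icc.mpr zero_le_one) 1
    (right_mem_Icc.mpr zero_le_one) zero_le_one
  have h0 : φ 0 = ⟪g u, w - u⟫ := by simp [hφdef]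
  have h1 : φ 1 = ⟪g w, w - u⟫ := by simp [hφdef]
  rw [inner_sub_left, ← h0, ← h1]
  linarith

end Mono

/-! ## §3 The two-cut-off comparison from the fine current -/

section Current

variable {E : Type*} [NormedAddCommGroup E] [InnerProductSpace ℝ E] [CompleteSpace E]

/-- **A LOCAL MINIMISER WITH A GRADIENT HAS GRADIENT ZERO** (Fermat, gradient form). [folklore] -/
theorem gradient_eq_zero_of_isLocalMin {f : E → ℝ} {w ga : E} (hmin : IsLocalMin f w) (hf : HasGradientAt f ga w) : ga = 0 := by
  have h := hmin.hasFDerivAt_eq_zero hf.hasFDerivAt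
  have : toDual ℝ E ga = toDual ℝ E 0 := by rw [h, map_zero]
  exact (toDual ℝ E).injective this

/-- ★ **THE TWO-CUT-OFF COMPARISON FROM THE FINE CURRENT**: `w` a local minimiser of `f̃` with gradient `ga` there (so `ga = 0`), `gb` the gradient of `f̃` at `u`, (Mono)
`m‖w − u‖² ≤ ⟪ga − gb, w − u⟫`, and (Cur) `‖gb‖ ≤ Λ` ⟹ `‖w − u‖ ≤ Λ/m`.  With `gb = ℓ† ∇A(σ u)` from `hasGradientAt_comp_of_envelope` and `norm_adjoint_apply_le`, (Cur) is
«the fine first variation of run `(K+1)`'s action at the one-step interpolation `σ(u)` of run `K`'s minimiser, on lifted slice directions, is `≤ Λ`». [cite: King1986, Prop. 3.9 (3.73)-(3.74) p.665] -/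
theorem norm_sub_le_div_of_current {f : E → ℝ} {u w ga gb : E} {m Λ : ℝ} (hm : 0 < m) (hΛ : 0 ≤ Λ)
    (hmin : IsLocalMin f w) (hfw : HasGradientAt f ga w) (hmono : m * ‖w - u‖ ^ 2 ≤ ⟪ga - gb, w - u⟫) (hcur : ‖gb‖ ≤ Λ) :
    ‖w - u‖ ≤ Λ / m := by
  have hga : ga = 0 := gradient_eq_zero_of_isLocalMin hmin hfw
  refine norm_sub_le_div_of_inner hm hΛ (by rw [hga, inner_zero_left]) hmono ?_
  calc |⟪gb, w - u⟫| ≤ ‖gb‖ * ‖w - u‖ := abs_real_inner_le_norm _ _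
    _ ≤ Λ * ‖w - u‖ := mul_le_mul_of_nonneg_right hcur (norm_nonneg _)

/-- ★ **ASSEMBLED**: the envelope data of §1 at `u` (selection `σ` through the one-step averaging `π`, fine action `A` with gradient `gA` at `σ u` satisfying the fibre
Euler–Lagrange equation, any lift `ℓ`), the fine-current bound (Cur) `|⟪gA, ℓ b⟫| ≤ Λ‖b‖`, a local minimiser `w` of `A ∘ σ` with a gradient there, and (Mono) between the pair (stated with `ℓ† gA`, which IS the gradient of `A ∘ σ` at `u` — first
conjunct) ⟹ `‖w − u‖ ≤ Λ/m`. [cite: King1986, Prop. 3.9 (3.73)-(3.74) p.665; Balaban1985Variational, Thm 1 p.279, (170)-(171) p.305] -/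
theorem norm_sub_le_div_of_envelope {𝔸 : Type*} [NormedAddCommGroup 𝔸] [InnerProductSpace ℝ 𝔸] [CompleteSpace 𝔸]
    {π : 𝔸 → E} {σ : E → 𝔸} {A : 𝔸 → ℝ} {u w ga : E} {π' : 𝔸 →L[ℝ] E} {σ' : E →L[ℝ] 𝔸} {gA : 𝔸} {m Λ : ℝ} (hm : 0 < m) (hΛ : 0 ≤ Λ)
    (hπσ : ∀ᶠ W' in 𝓝 u, π (σ W') = W') (hπ : HasFDerivAt π π' (σ u)) (hσ : HasFDerivAt σ σ' u) (hA : HasGradientAt A gA (σ u))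
    (hEL : ∀ v, π' v = 0 → ⟪gA, v⟫ = 0) (ℓ : E →L[ℝ] 𝔸) (hℓ : ∀ b, π' (ℓ b) = b) (hcur : ∀ b, |⟪gA, ℓ b⟫| ≤ Λ * ‖b‖)
    (hmin : IsLocalMin (A ∘ σ) w) (hfw : HasGradientAt (A ∘ σ) ga w)
    (hmono : m * ‖w - u‖ ^ 2 ≤ ⟪ga - (ContinuousLinearMap.adjoint ℓ) gA, w - u⟫) :
    HasGradientAt (A ∘ σ) ((ContinuousLinearMap.adjoint ℓ) gA) u ∧ ‖w - u‖ ≤ Λ / m :=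
  ⟨hasGradientAt_comp_of_envelope hπσ hπ hσ hA hEL ℓ hℓ,
    norm_sub_le_div_of_current hm hΛ hmin hfw hmono (norm_adjoint_apply_le ℓ gA hΛ hcur)⟩

end Current

/-! ## §4 The quadratic model: the one-step minimiser is `H = GQ†(QGQ†)⁻¹` and, by the envelope formula with ANY lift, `∇A¹ = (QGQ†)⁻¹` -/

section Quadratic

variable {𝔸 ℬ : Type*} [NormedAddCommGroup 𝔸] [InnerProductSpace ℝ 𝔸] [CompleteSpace 𝔸] [NormedAddCommGroup ℬ] [InnerProductSpace ℝ ℬ] [CompleteSpace ℬ]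

/-- **THE PULLED-BACK CURRENT IS THE MULTIPLIER, FOR EVERY LIFT**: if the fine first variation at the one-step minimiser is a pure constraint force, `S(σ b) = Q† μ`, then for
ANY continuous linear lift `ℓ` of `Q` (`Q ∘ ℓ = id`), `ℓ†(S (σ b)) = μ` (`ℓ†Q† = (Qℓ)† = id`). [cite: Balaban1984PropagatorsII, (2.21)-(2.23) p.226] -/
theorem adjoint_lift_apply_eq_multiplier (Q : 𝔸 →L[ℝ] ℬ) (ℓ : ℬ →L[ℝ] 𝔸) (hℓ : ∀ b, Q (ℓ b) = b) {J : 𝔸} {μ : ℬ}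
    (hJ : J = (ContinuousLinearMap.adjoint Q) μ) : (ContinuousLinearMap.adjoint ℓ) J = μ := by
  subst hJ
  refine ext_inner_right ℝ fun b => ?_
  rw [ContinuousLinearMap.adjoint_inner_left, ContinuousLinearMap.adjoint_inner_left, hℓ]

/-- ★ **THE QUADRATIC MODEL** (abelian / linearised template, [Balaban1984PropagatorsII] Sect. A, [King1986] §3): fine action `A(x) = ½⟪x, Sx⟫` with `S` symmetric and
nonnegative, inverse `G` (`S ∘ G = id`), linear averaging `Q`, and `E` a right inverse of `QGQ†` (`QGQ†E = id`, print's `(QGQ*)⁻¹`).  Then the configuration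
`σ b := G(Q†(E b))` — Bałaban's `H b`, the tree's `B6SectA.hOp` shape — (i) lies in the fibre of `b` (`Q(σ b) = b`), (ii) has fine first variation a pure constraint force
(`S(σ b) = Q†(E b)`), hence (iii) satisfies the fibre Euler–Lagrange equation (`⟪S(σ b), v⟫ = 0` for `Qv = 0`), (iv) MINIMISES `A` over the fibre, and (v) for ANY lift `ℓ` of `Q`,
`ℓ†(S(σ b)) = E b`: by the envelope formula the gradient of the one-step effective action `A ∘ σ` is the NEXT-SCALE INVERSE PROPAGATOR `(QGQ†)⁻¹` — the composition law of
propagators read as an instance of §1. [cite: Balaban1984PropagatorsII, (2.17)-(2.23) pp.225-226; King1986, Prop. 3.9 (3.73)-(3.74) p.665] -/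
theorem quadratic_oneStep (S G : 𝔸 →L[ℝ] 𝔸) (Q : 𝔸 →L[ℝ] ℬ) (E : ℬ →L[ℝ] ℬ) (hS : ∀ x y, ⟪S x, y⟫ = ⟪x, S y⟫) (hS0 : ∀ x, 0 ≤ ⟪x, S x⟫)
    (hSG : ∀ x, S (G x) = x) (hE : ∀ b, Q (G ((ContinuousLinearMap.adjoint Q) (E b))) = b) (b : ℬ) :
    Q (G ((ContinuousLinearMap.adjoint Q) (E b))) = b ∧
      S (G ((ContinuousLinearMap.adjoint Q) (E b))) = (ContinuousLinearMap.adjoint Q) (E b) ∧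
      (∀ v, Q v = 0 → ⟪S (G ((ContinuousLinearMap.adjoint Q) (E b))), v⟫ = 0) ∧
      IsMinOn (fun x => (1 / 2 : ℝ) * ⟪x, S x⟫) {x | Q x = b} (G ((ContinuousLinearMap.adjoint Q) (E b))) ∧
      ∀ ℓ : ℬ →L[ℝ] 𝔸, (∀ b', Q (ℓ b') = b') → (ContinuousLinearMap.adjoint ℓ) (S (G ((ContinuousLinearMap.adjoint Q) (E b)))) = E b := by
  set σb := G ((ContinuousLinearMap.adjoint Q) (E b)) with hσb
  have h2 : S σb = (ContinuousLinearMap.adjoint Q) (E b) := hSG _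
  have h3 : ∀ v, Q v = 0 → ⟪S σb, v⟫ = 0 := fun v hv => by
    rw [h2, ContinuousLinearMap.adjoint_inner_left, hv, inner_zero_right]
  refine ⟨hE b, h2, h3, fun x hx => ?_, fun ℓ hℓ => adjoint_lift_apply_eq_multiplier Q ℓ hℓ h2⟩
  -- minimality over the affine fibre: `½⟪x,Sx⟫ − ½⟪σb,Sσb⟫ = ½⟪x−σb, S(x−σb)⟫ + ⟪S σb, x − σb⟫`, the last term a constraint force against a fibre direction
  have hx' : Q (x - σb) = 0 := by rw [map_sub, show Q x = b from hx, hE b, sub_self]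
  have hcross : ⟪S σb, x - σb⟫ = 0 := h3 _ hx'
  show (1 / 2 : ℝ) * ⟪σb, S σb⟫ ≤ (1 / 2 : ℝ) * ⟪x, S x⟫
  have hexp : ⟪x, S x⟫ = ⟪σb, S σb⟫ + 2 * ⟪S σb, x - σb⟫ + ⟪x - σb, S (x - σb)⟫ := by
    have e1 : x = σb + (x - σb) := by abel
    conv_lhs => rw [e1]
    rw [map_add, inner_add_left, inner_add_right, inner_add_right, ← hS σb (x - σb), real_inner_comm (S σb) (x - σb)]
    ring
  rw [hexp, hcross]
  have := hS0 (x - σb)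
  linarith

omit [CompleteSpace ℬ] in
/-- **(Grad) IN THE QUADRATIC MODEL IS A DIFFERENCE OF INVERSE PROPAGATORS ON ONE SMOOTH FIELD**: with run `K`'s Euler–Lagrange equation on its slice `N` (`⟪S_K u, h⟫ = 0` for
`h ∈ N`, [Balaban1985Variational] (171)) the approximate-criticality input (Grad) `|⟪E u, h⟫| ≤ Λ‖h‖` for the one-step effective gradient `E u = (QG_{K+1}Q†)⁻¹u` is EXACTLY a bound on
`(E − c·S_K) u` tested on the slice, any constant `c` — [King1986] Prop. 3.9's «difference of propagators on one line». [cite: King1986, Prop. 3.9 (3.73)-(3.74) p.665] -/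
theorem grad_of_propagatorDifference (N : Submodule ℝ ℬ) (E S : ℬ →L[ℝ] ℬ) (c Λ : ℝ) (u : ℬ) (hEL : ∀ h ∈ N, ⟪S u, h⟫ = 0)
    (hdiff : ∀ h ∈ N, |⟪(E - c • S) u, h⟫| ≤ Λ * ‖h‖) : ∀ h ∈ N, |⟪E u, h⟫| ≤ Λ * ‖h‖ := by
  intro h hh
  have := hdiff h hh
  change |⟪E u - c • S u, h⟫| ≤ Λ * ‖h‖ at this
  rwa [inner_sub_left, real_inner_smul_left, hEL h hh, mul_zero, sub_zero] at this

end Quadratic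

/-! ## §5 The junction with the sup-norm (contraction) display of `…KernelLegCfgFixedPoint`: the Picard map of the one-step effective action -/

section Picard

variable {E E' : Type*} [NormedAddCommGroup E] [NormedSpace ℝ E] [NormedAddCommGroup E'] [NormedSpace ℝ E']

/-- **PICARD MAP OF A CURRENT**: for `T x := x − G(J x)` (`J` = a current / first variation, `G` = a linear «Green's operator»), `x` is a fixed point of `T` iff `G (J x) = 0` —
in particular every critical point (`J x = 0`) is a fixed point, and conversely when `G` is injective.  This is the shape of [Balaban1985Variational]'s successive-approximation map
(116) for the critical-point equation (111). [cite: Balaban1985Variational, (111) p.294, (116) p.295] -/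
theorem isFixedPt_picard_iff (G : E' →L[ℝ] E) (J : E → E') (x : E) : Function.IsFixedPt (fun y => y - G (J y)) x ↔ G (J x) = 0 := by
  rw [Function.IsFixedPt, sub_eq_self]

/-- ★ **THE DEFECT OF THE PICARD MAP AT A POINT IS THE GREEN'S OPERATOR APPLIED TO THE CURRENT THERE**: `‖T u − u‖ = ‖G (J u)‖ ≤ ‖G‖·Λ` whenever `‖J u‖ ≤ Λ`.  READING (the
junction with the seat's sup-norm route: the generic a-posteriori contraction bound ✓ `norm_sub_le_weighted_of_isFixedPt` (`…KernelLegCfgFixedPoint` §1, legwise weighted sup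
currency on a finite bond set) applied on the FINE bond-indexed chart, then ✓ `cfgDistCauchyΦ_of_fineComparison`): take `T` := the Picard map of run `(K+1)`'s ONE-STEP effective
action `A¹_{K+1} ∘ chart` on run `K`'s slice and `u := coord(U_K)`; then the contraction bound's defect `‖T u − u‖` is `‖G_K(J u)‖` with `J u = ℓ†∇A_{K+1}(σ u)` (resp.
`A′_{K+1}(σ u) ∘ ℓ` at the Fréchet level) by the envelope formula §1 — the SAME quantity (Cur) as in the Hilbert route §3, now in whatever (weighted sup) norm the contraction is
displayed in.  The Hilbert route closes by strong monotonicity (an L²-mechanism); the sup-norm route closes by contraction ([Balaban1985Variational] (116)–(121),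
[Balaban1985BackgroundPropagators] Thm 3.13's weighted sup bounds on `G`) — K-uniformly in print's norms (115).  Both consume (Cur). [cite: Balaban1985Variational, (116)-(121) p.295; King1986, Prop. 3.9 (3.73)-(3.74) p.665] -/
theorem norm_picard_sub_self_le (G : E' →L[ℝ] E) (J : E → E') (u : E) {Λ : ℝ} (hJ : ‖J u‖ ≤ Λ) :
    ‖(u - G (J u)) - u‖ ≤ ‖G‖ * Λ := by
  rw [sub_sub_cancel_left, norm_neg]
  exact (G.le_opNorm _).trans (mul_le_mul_of_nonneg_left hJ (norm_nonneg _))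

/-- **THE BANACH (dual-pairing) FORM OF THE CORE INEQUALITY**: in ANY real normed space, if the derivative `a = f′(w)` kills `w − u`, the derivative is `m`-strongly monotone
between the pair in the dual pairing (`m‖w − u‖² ≤ (a − b)(w − u)`, `b = f′(u)`) and `|b (w − u)| ≤ Λ‖w − u‖`, then `‖w − u‖ ≤ Λ/m` — the Hilbert lemma
`norm_sub_le_div_of_inner` with `⟪·,·⟫` replaced by the pairing `E* × E`.  (Located caveat: for the Wilson action strong monotonicity holds K-uniformly in the `L²` pairing, NOT in
sup norm — `⟨h, Δ₁h⟩ ~ η^{d−2}‖h‖²_sup` on a one-site `h` — which is why print closes the sup-norm route by contraction, §5's first two lemmas.) [folklore] -/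
theorem norm_sub_le_div_of_pairing {u w : E} (a b : E →L[ℝ] ℝ) {m Λ : ℝ} (hm : 0 < m) (hΛ : 0 ≤ Λ) (hcrit : a (w - u) = 0)
    (hmono : m * ‖w - u‖ ^ 2 ≤ (a - b) (w - u)) (hgrad : |b (w - u)| ≤ Λ * ‖w - u‖) : ‖w - u‖ ≤ Λ / m := by
  have h1 : m * ‖w - u‖ ^ 2 ≤ Λ * ‖w - u‖ := by
    change m * ‖w - u‖ ^ 2 ≤ a (w - u) - b (w - u) at hmono
    rw [hcrit, zero_sub] at hmono
    exact hmono.trans ((neg_le_abs _).trans hgrad)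
  rw [le_div_iff₀ hm]
  rcases (norm_nonneg (w - u)).eq_or_lt with h0 | hpos
  · rw [← h0]; simpa using hΛ
  · nlinarith

end Picard

/-! ## §6 (v1.1 append) The curve form of (Crit) for the averaged minimiser at the tree's objects: the one-step effective action is critical along every fibre curve -/

section T3Curve

open Literature.MathematicalPhysics.QuantumFieldTheory.Balaban1983to89
open Literature.MathematicalPhysics.QuantumFieldTheory.Balaban1983to89.T3ContinuumYM3Torus
open Literature.MathematicalPhysics.QuantumFieldTheory.Balaban1983to89.T3UnitLawDensityEML (ℰp)
open Literature.MathematicalPhysics.QuantumFieldTheory.Balaban1983to89.T3TiltDescent (descendTo)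
open Literature.MathematicalPhysics.QuantumFieldTheory.Balaban1983to89.T3ConstrainedMinimiser (fibre minAction)

/-- ★ **PRINT'S (170)–(171) FOR THE ONE-STEP CLASSICAL EFFECTIVE ACTION, AT THE TREE'S OBJECTS** (hypothesis-free beyond `IsMinOn`; the chart-free curve form of display (Crit) of
`cfgDistCauchyΦ_of_variational` for `Ū_{K′}`): if `U′` minimises the Wilson action over `fibre F ℰp n K′ V`, then along EVERY curve `γ` of run-`K` configurations through the averaged
minimiser `descendTo F ℰp K K′ U′` that stays in `fibre F ℰp n K V` near `t = 0`, the one-step effective action `t ↦ minAction F ℰp K K′ (γ t)` has a local minimum at `0`, hence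
`deriv (minAction ∘ γ) 0 = 0` (Mathlib's `IsLocalMin.deriv_eq_zero`, no differentiability needed) — the companion, for `A¹ = minAction K K′`, of `Prop8Criticality.lin_eq_zero_of_isMinOn_of_hasDerivAt`
(which is (171) for the Wilson action itself); from `isMinOn_minAction_descendTo_of_isMinOn_ℰp` (✓ `…KernelLegCfgVariational` §1′).
[cite: Balaban1985Variational, (170)-(171) p.305, (141) p.299; Balaban1985UV3, (41)-(42) p.266] -/
theorem deriv_minAction_comp_eq_zero_of_isMinOn_ℰp (F : T3Family) {n K K' : ℕ} (h₁ : n ≤ K) (h₂ : K ≤ K')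
    {V : GaugeField (F.P n) 0 (Matrix.specialUnitaryGroup (Fin 2) ℂ)} {U' : GaugeField (F.P K') 0 (Matrix.specialUnitaryGroup (Fin 2) ℂ)}
    (hU' : U' ∈ fibre F ℰp n K' (h₁.trans h₂) V) (hmin : IsMinOn (fun U => wilsonAction4 U) (fibre F ℰp n K' (h₁.trans h₂) V) U')
    (γ : ℝ → GaugeField (F.P K) 0 (Matrix.specialUnitaryGroup (Fin 2) ℂ)) (hγ0 : γ 0 = descendTo F ℰp K K' h₂ U')
    (hγ : ∀ᶠ t : ℝ in 𝓝 0, γ t ∈ fibre F ℰp n K h₁ V) :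
    IsLocalMin (fun t : ℝ => minAction F ℰp K K' h₂ (γ t)) 0 ∧ deriv (fun t : ℝ => minAction F ℰp K K' h₂ (γ t)) 0 = 0 := by
  have hW := (isMinOn_minAction_descendTo_of_isMinOn_ℰp F h₁ h₂ hU' hmin).2.1
  have hloc : IsLocalMin (fun t : ℝ => minAction F ℰp K K' h₂ (γ t)) 0 := by
    show ∀ᶠ t : ℝ in 𝓝 0, minAction F ℰp K K' h₂ (γ 0) ≤ minAction F ℰp K K' h₂ (γ t)
    filter_upwards [hγ] with t ht
    rw [hγ0]
    exact hW ht
  exact ⟨hloc, hloc.deriv_eq_zero⟩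

/-- **GLOBAL FORM**: if the curve stays in the fibre for ALL `t`, the one-step effective action along it is minimal at `0` outright. [cite: Balaban1985Variational, (170)-(171) p.305] -/
theorem isMinOn_minAction_comp_of_isMinOn_ℰp (F : T3Family) {n K K' : ℕ} (h₁ : n ≤ K) (h₂ : K ≤ K')
    {V : GaugeField (F.P n) 0 (Matrix.specialUnitaryGroup (Fin 2) ℂ)} {U' : GaugeField (F.P K') 0 (Matrix.specialUnitaryGroup (Fin 2) ℂ)}
    (hU' : U' ∈ fibre F ℰp n K' (h₁.trans h₂) V) (hmin : IsMinOn (fun U => wilsonAction4 U) (fibre F ℰp n K' (h₁.trans h₂) V) U')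
    (γ : ℝ → GaugeField (F.P K) 0 (Matrix.specialUnitaryGroup (Fin 2) ℂ)) (hγ0 : γ 0 = descendTo F ℰp K K' h₂ U') (hγ : ∀ t, γ t ∈ fibre F ℰp n K h₁ V) :
    IsMinOn (fun t : ℝ => minAction F ℰp K K' h₂ (γ t)) Set.univ 0 := by
  intro t _
  show minAction F ℰp K K' h₂ (γ 0) ≤ minAction F ℰp K K' h₂ (γ t)
  rw [hγ0]
  exact (isMinOn_minAction_descendTo_of_isMinOn_ℰp F h₁ h₂ hU' hmin).2.1 (hγ t)

end T3Curve

end Summit.QuantumFields.YangMills.Theorems.GlobalSlackKernelLeg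

end
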